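import Literature.AnabelianGeometry.SemiGraphs.TemperedEdgeLikeCentralizerOfHomToGroup
import Literature.AnabelianGeometry.SemiGraphs.TemperedThm37iiiIffNoAnchorFree
import HarnessLib

/-!
# Tempered van Kampen at CONSTANT coefficients, finite levels: a compatible family of local homomorphisms
# `Φ_v : Π_v → G`, `Φ_e : Π_e → G` induces `ρ_N : π₁^temp(H) → G/N` at EVERY chart, matching the verticial and edge
# homomorphisms up to conjugation ([SemiAnbd] Thm. 3.7 (i)/(iii) pp. 40–41; Prop. 3.6 (iii) p. 38; Rmk. 3.1.2 p. 33)

Mochizuki, *Semi-graphs of anabelioids*, Publ. RIMS **42** (2006), §3: Thm. 3.7 (i) p. 40 ("a natural continuous …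
outer homomorphism `π̂₁(G_v) → π₁^temp(G)`" — the verticial homomorphisms), (iii) p. 41 (the edge-like subgroups), Prop. 3.6
(iii) p. 38 (finite objects of `B^temp(G)` and finite quotients of `π₁^temp(G)`), Rmk. 3.1.2 p. 33 (the Galois objects `Π/N`)
[cite: MochizukiSemiAnbd2006, Thm 3.7(i) p.40] [cite: MochizukiSemiAnbd2006, Prop 3.6(iii) p.38].

PROOF-ONLY file (abc-iut cell, layer L3 [SemiAnbd], block-F seat abc-iut-f-169 gen 4; L3-lead g9 row
«TEMPERED-VAN-KAMPEN@CONSTANT-COEFFICIENTS» (ε3 GO 2026-08-27T11:39Z; G-constant sub-row of the UNOWNED δ11 row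
«TEMPERED-VAN-KAMPEN-QUOTIENT» "compatible vertex quotients ⇒ `Π^tp_𝔾 → π₁(𝔔)`"), SHAPES 2c8d0bf4a130457e FILE A;
0 `def` · 0 `instance` · 0 notation · 0 `Prop` fact · 0 `sorry`).

## What is proved
For `Φ : HomToGroup H G` (abc-iut-f-169's `HomToGroupCoverings`, p525155: continuous `Φ_v : Π_v → G`, `Φ_e : Π_e → G` with
`Φ_v ∘ b_* = Φ_e` — the «kill the graph» datum), `G` a compact totally disconnected group with an open normal subgroup `N`, and
`H` satisfying the hypotheses of Prop. 3.6:

* §1 `IsVerticialHom.exists_equiv_natural_family` — Thm. 3.7 (i) in `B^temp(H)` as a NATURAL family (one `ε_S` per covering,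
  equivariant, natural along every morphism of coverings; vertex twin of the edge lemma of
  `TemperedEdgeLikeCentralizerOfCoveringSeparated`, p526872);
* §2 vertex laws of the level coverings `Φ^*(G/N)` and of their deck transformations `Φ^*(r_g)`;
* §3 the core computation `symm_ρ_apply_eq_conj`: two deck-natural identifications of `G/N` with the chart image of `Φ^*(G/N)`
  differ by a LEFT translation (`exists_symm_trans_eq_mul`, from abc-iut-f-169's
  `exists_forall_eq_mul_of_forall_mul_right`, p526053), so an identification equivariant along `χ : Π → π₁^temp(H)` over
  `a : Π → G` reads the action through `χ` as left multiplication by a CONJUGATE of `a`;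
* §4 `HomToGroup.exists_levelHom_of_equiv` (the monodromy of `Φ^*(G/N)` read through ANY deck-natural identification `e₀` is a
  continuous homomorphism `ρ` CHARACTERISED by `e₀⁻¹(x · e₀(zN)) = ρ(x) zN` — the form the profinite assembly uses) and
  ★ `HomToGroup.exists_levelHom` — **tempered van Kampen, level `N`**: at EVERY chart `c` there is a continuous homomorphism
  `ρ_N : π₁^temp(H) = c.G → G/N` with `ρ_N ∘ ψ_v = (k_v Φ_v k_v⁻¹) mod N` for every vertex `v` and verticial `ψ_v`, and
  `ρ_N ∘ ψ_e = (k_e Φ_e k_e⁻¹) mod N` for every edge `e` and edge homomorphism `ψ_e` (construction: the monodromy of the finite Galois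
  covering `Φ^*(G/N)` read through the Thm. 3.7 (i) identification at one vertex commutes with the deck transformations, hence acts by
  left translations; continuity: the kernel is an open stabiliser);
* §5 ★ `HomToGroup.exists_hom_of_finite` — **FINITE `G`**: `ρ : π₁^temp(H) → G` with `ρ ∘ ψ_v = k Φ_v k⁻¹`, `ρ ∘ ψ_e = k Φ_e k⁻¹`
  — the case that builds CHARACTERS / FOLDS / permutation representations of `π₁^temp(H)` from local data (consumers: the
  separation tests `not_exists_edgeLike_ge_of_character/_of_separated` of abc-iut-f-176, the translation characters of the
  abc-iut-L3-t8 lineage, …).  The PROFINITE assembly (`ρ : π₁^temp(H) → G` by completeness of `G`) is the sequel file.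

Binder census: structural data + `Prop36Hypotheses H` (a vertex carries a verticial homomorphism; finite coverings are tempered)
+ compactness / total disconnectedness / finiteness of `G` as displayed; FACT 0 · GAP 0 · smuggled 0.  Honest framing: a theorem
about the tree's OWN charts and coverings (the universal property is proved, not postulated); the full δ11 quotient statement (target
`π₁` of a finite graph of finite groups, with stable letters) is NOT claimed; nothing here takes a side on [IUTchIII] Cor. 3.12; typed ≠
proved for anything of the IUT series; nothing asserts that abc is proved or refuted.
-/

namespace Literature.AnabelianGeometry.SemiGraphs

namespace ProfiniteSemiGraph

open CategoryTheory Topology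
open Literature.AlgebraicGeometry.Frobenioids.QuasiTemperoid.BTempConnected (hom_ρ ρ_one_apply ρ_mul_apply)

universe u

variable {ℋ : ProfiniteSemiGraph.{u}}

/-! ### 1. Thm. 3.7 (i) read in `B^temp(H)` as a NATURAL family (vertex twin of `IsEdgeHom.exists_equiv_natural_family`) -/

/-- A verticial homomorphism `ψ : Π_v → π₁^temp(H)` identifies `S_v` with the chart image `c(S)|_ψ` by ONE bijection `ε_S` PER
COVERING, `Π_v`-equivariant along `ψ`, and natural along EVERY morphism `S ⟶ S′` of tempered coverings.
[cite: MochizukiSemiAnbd2006, Thm 3.7(i) p.40] -/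
theorem IsVerticialHom.exists_equiv_natural_family {c : TemperedPiChart ℋ} {v : ℋ.graph.Vertex}
    {ψ : ℋ.Gv v →ₜ* c.G} (hψ : IsVerticialHom c v ψ) :
    ∃ ε : ∀ S : BTempCat ℋ, (S.obj.SV v).obj.V ≃ (c.equiv.functor.obj S).obj.V,
      (∀ (S : BTempCat ℋ) (γ : ℋ.Gv v) (s : (S.obj.SV v).obj.V),
        ε S ((S.obj.SV v).obj.ρ γ s) = (c.equiv.functor.obj S).obj.ρ (ψ γ) (ε S s)) ∧
      ∀ (S S' : BTempCat ℋ) (δ : S ⟶ S') (s : (S.obj.SV v).obj.V),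
        ε S' ((δ.hom.fV v).hom.hom s) = (c.equiv.functor.map δ).hom.hom.hom (ε S s) := by
  obtain ⟨η⟩ := hψ
  let i : ∀ S : BTempCat ℋ, S.obj.SV v ≅ (BTemp.res ψ).obj (c.equiv.functor.obj S) := fun S =>
    (ObjectProperty.ι _ ⋙ restrictV ℋ v).mapIso (c.equiv.unitIso.app S) ≪≫ η.app (c.equiv.functor.obj S)
  refine ⟨fun S => BTemp.equivOfIso (i S), fun S γ s => BTemp.equivOfIso_ρ (i S) γ s, fun S S' δ s => ?_⟩
  let w : ∀ T : BTempCat ℋ, (T.obj.SV v).obj.V →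
      (((c.equiv.functor ⋙ c.equiv.inverse).obj T).obj.SV v).obj.V :=
    fun T x => ((c.equiv.unitIso.hom.app T).hom.fV v).hom.hom x
  have h1 : w S' ((δ.hom.fV v).hom.hom s) =
      ((c.equiv.inverse.map (c.equiv.functor.map δ)).hom.fV v).hom.hom (w S s) := by
    have := congrArg (fun φ => ((ObjectProperty.ι _ ⋙ restrictV ℋ v).map φ).hom.hom s)
      (c.equiv.unitIso.hom.naturality δ)
    exact this
  have h2 : (η.hom.app (c.equiv.functor.obj S')).hom.hom
        (((c.equiv.inverse.map (c.equiv.functor.map δ)).hom.fV v).hom.hom (w S s)) =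
      (c.equiv.functor.map δ).hom.hom.hom ((η.hom.app (c.equiv.functor.obj S)).hom.hom (w S s)) := by
    have := congrArg (fun φ => φ.hom.hom (w S s)) (η.hom.naturality (c.equiv.functor.map δ))
    exact this
  change (η.hom.app (c.equiv.functor.obj S')).hom.hom (w S' ((δ.hom.fV v).hom.hom s)) =
    (c.equiv.functor.map δ).hom.hom.hom ((η.hom.app (c.equiv.functor.obj S)).hom.hom (w S s))
  rw [h1, h2]

namespace HomToGroup

variable {G : Type u} [Group G] [TopologicalSpace G] [IsTopologicalGroup G] (hG : IsTempered G)
  (Φ : HomToGroup ℋ G)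

/-! ### 2. The level-`N` coverings `Φ^*(G/N)`: vertex laws (the edge laws are in `TemperedEdgeLikeCentralizerOfHomToGroup`) -/

/-- The vertex fibre action of `Φ^*(G/N)`: `γ · zN = Φ_v(γ) z N`. [cite: MochizukiSemiAnbd2006, §3 p.36] -/
theorem pullback_Q_ρV_apply (N : OpenNormalSubgroup G) (v : ℋ.graph.Vertex) (γ : ℋ.Gv v) (z : G) :
    ((Φ.pullback.obj (BTemp.Q hG N)).SV v).obj.ρ γ (z : G ⧸ N.toSubgroup) =
      ((Φ.fv v γ * z : G) : G ⧸ N.toSubgroup) := by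
  rw [pullback_ρV_apply, BTemp.Q_ρ_apply]

/-- The deck transformation `Φ^*(r_g)` acts on every vertex fibre by `zN ↦ zgN`. [cite: MochizukiSemiAnbd2006, Rmk 3.1.2 p.33] -/
theorem pullback_rightMul_fV_apply (N : OpenNormalSubgroup G) (g : G) (v : ℋ.graph.Vertex) (q : G ⧸ N.toSubgroup) :
    ((Φ.pullback.map (BTemp.rightMul hG N g)).fV v).hom.hom q = q * (g : G ⧸ N.toSubgroup) := by
  rw [pullback_map_fV_apply, BTemp.rightMul_apply']

/-! ### 3. The core computation: a fibre identification that is deck-natural and equivariant along a homomorphism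
`χ : Π → π₁^temp(H)` over `a : Π → G` reads the `π₁^temp(H)`-action through `χ` as LEFT multiplication by a conjugate of `a` -/

section Core

variable (h36 : ℋ.Prop36Hypotheses) (N : OpenNormalSubgroup G) [Finite (BTemp.Q hG N).obj.V]
  (c : TemperedPiChart ℋ)

/-- If `e₀, η : G/N ≃ Y` (`Y` the chart image of `Φ^*(G/N)`) both intertwine the deck transformations `Φ^*(r_g)` with right
translation by `g`, then `e₀⁻¹ ∘ η` is LEFT multiplication by some `k ∈ G`. [cite: MochizukiSemiAnbd2006, Rmk 3.1.2 p.33] -/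
theorem exists_symm_trans_eq_mul
    (e₀ η : (G ⧸ N.toSubgroup) ≃ (c.equiv.functor.obj (Φ.pullbackTemp h36 (BTemp.Q hG N))).obj.V)
    (he₀ : ∀ (g : G) (q : G ⧸ N.toSubgroup), e₀ (q * (g : G ⧸ N.toSubgroup)) =
      (c.equiv.functor.map (Φ.pullbackTempMap h36 (BTemp.rightMul hG N g))).hom.hom.hom (e₀ q))
    (hη : ∀ (g : G) (q : G ⧸ N.toSubgroup), η (q * (g : G ⧸ N.toSubgroup)) =
      (c.equiv.functor.map (Φ.pullbackTempMap h36 (BTemp.rightMul hG N g))).hom.hom.hom (η q)) :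
    ∃ k : G, ∀ z : G, e₀.symm (η (z : G ⧸ N.toSubgroup)) = ((k * z : G) : G ⧸ N.toSubgroup) := by
  refine exists_forall_eq_mul_of_forall_mul_right N.toSubgroup (fun q => e₀.symm (η q)) fun g z => ?_
  apply e₀.injective
  rw [Equiv.apply_symm_apply, QuotientGroup.mk_mul, hη, he₀, Equiv.apply_symm_apply]

/-- **The action of `π₁^temp(H)` through a fibre identification is left multiplication by a conjugate.**  Let `Y` be the chart image of
`S = Φ^*(G/N)`, `e₀ : G/N ≃ Y` a deck-natural bijection (used to read the action of `c.G` on `Y` in `G/N`), and `η : G/N ≃ Y` another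
deck-natural bijection that is equivariant along `χ : Π → c.G` over `a : Π → G` (`η (a(γ) zN) = χ(γ) · η (zN)`).  Then for some
`k ∈ G`: `e₀⁻¹ (χ(γ) · e₀ (zN)) = k a(γ) k⁻¹ · e₀⁻¹… ` — precisely, `e₀⁻¹ (χ γ · e₀ 1) = k · a γ · k⁻¹ · N` for all `γ`, and the
`e₀`-read action of every `x ∈ c.G` is left multiplication: `e₀⁻¹ (x · e₀ (zN)) = e₀⁻¹ (x · e₀ 1) · zN`.
[cite: MochizukiSemiAnbd2006, Thm 3.7(i) p.40] -/
theorem symm_ρ_apply_eq_conj {P : Type*} [Group P] (χ : P →* c.G) (a : P →* G)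
    (e₀ η : (G ⧸ N.toSubgroup) ≃ (c.equiv.functor.obj (Φ.pullbackTemp h36 (BTemp.Q hG N))).obj.V)
    (he₀ : ∀ (g : G) (q : G ⧸ N.toSubgroup), e₀ (q * (g : G ⧸ N.toSubgroup)) =
      (c.equiv.functor.map (Φ.pullbackTempMap h36 (BTemp.rightMul hG N g))).hom.hom.hom (e₀ q))
    (hη : ∀ (g : G) (q : G ⧸ N.toSubgroup), η (q * (g : G ⧸ N.toSubgroup)) =
      (c.equiv.functor.map (Φ.pullbackTempMap h36 (BTemp.rightMul hG N g))).hom.hom.hom (η q))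
    (hηρ : ∀ (γ : P) (z : G), η ((a γ * z : G) : G ⧸ N.toSubgroup) =
      (c.equiv.functor.obj (Φ.pullbackTemp h36 (BTemp.Q hG N))).obj.ρ (χ γ) (η (z : G ⧸ N.toSubgroup))) :
    ∃ k : G, ∀ γ : P,
      e₀.symm ((c.equiv.functor.obj (Φ.pullbackTemp h36 (BTemp.Q hG N))).obj.ρ (χ γ)
        (e₀ ((1 : G) : G ⧸ N.toSubgroup))) = ((k * a γ * k⁻¹ : G) : G ⧸ N.toSubgroup) := by
  obtain ⟨k, hk⟩ := Φ.exists_symm_trans_eq_mul hG h36 N c e₀ η he₀ hη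
  -- `e₀ 1 = η (k⁻¹ N)`: from `e₀.symm (η (k⁻¹ N)) = (k k⁻¹) N = 1`
  have h1 : e₀ ((1 : G) : G ⧸ N.toSubgroup) = η ((k⁻¹ : G) : G ⧸ N.toSubgroup) := by
    have := hk k⁻¹
    rw [mul_inv_cancel] at this
    rw [← this, Equiv.apply_symm_apply]
  refine ⟨k, fun γ => ?_⟩
  rw [h1, ← hηρ γ k⁻¹, hk, ← mul_assoc]

end Core

/-! ### 4. The level-`N` retraction `ρ_N : π₁^temp(H) → G/N` -/

section Level

variable (h36 : ℋ.Prop36Hypotheses) (N : OpenNormalSubgroup G) [Finite (BTemp.Q hG N).obj.V]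
  (c : TemperedPiChart ℋ)

/-- **The monodromy of `Φ^*(G/N)` read through a deck-natural identification is a continuous homomorphism to `G/N`.**  Let `Y` be
the chart image of `S = Φ^*(G/N)` and `e₀ : G/N ≃ Y` a bijection intertwining right translation by `g` with the deck transformation
`Φ^*(r_g)`.  Then there is a (unique) continuous homomorphism `ρ : c.G → G/N` CHARACTERISED by `e₀⁻¹ (x · e₀ (zN)) = ρ(x) · zN` for all
`x ∈ c.G`, `z ∈ G`: the `e₀`-read action of `c.G` is left multiplication through `ρ` (it commutes with right translations);
continuity: `ker ρ` is the open stabiliser of `e₀(1)`. [cite: MochizukiSemiAnbd2006, Prop 3.6(iii) p.38] -/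
theorem exists_levelHom_of_equiv
    (e₀ : (G ⧸ N.toSubgroup) ≃ (c.equiv.functor.obj (Φ.pullbackTemp h36 (BTemp.Q hG N))).obj.V)
    (he₀ : ∀ (g : G) (q : G ⧸ N.toSubgroup), e₀ (q * (g : G ⧸ N.toSubgroup)) =
      (c.equiv.functor.map (Φ.pullbackTempMap h36 (BTemp.rightMul hG N g))).hom.hom.hom (e₀ q)) :
    ∃ ρ : c.G →ₜ* (G ⧸ N.toSubgroup), ∀ (x : c.G) (z : G),
      e₀.symm ((c.equiv.functor.obj (Φ.pullbackTemp h36 (BTemp.Q hG N))).obj.ρ x (e₀ (z : G ⧸ N.toSubgroup))) =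
        ρ x * (z : G ⧸ N.toSubgroup) := by
  classical
  let Y : BTemp c.G := c.equiv.functor.obj (Φ.pullbackTemp h36 (BTemp.Q hG N))
  -- the `e₀`-read action of every `x ∈ c.G` commutes with right translations, hence is a left translation
  let ρf : c.G → G ⧸ N.toSubgroup := fun x => e₀.symm (Y.obj.ρ x (e₀ ((1 : G) : G ⧸ N.toSubgroup)))
  have hleft : ∀ (x : c.G) (z : G),
      e₀.symm (Y.obj.ρ x (e₀ (z : G ⧸ N.toSubgroup))) = ρf x * (z : G ⧸ N.toSubgroup) := by
    intro x
    obtain ⟨h, hh⟩ := exists_forall_eq_mul_of_forall_mul_right N.toSubgroup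
      (fun q => e₀.symm (Y.obj.ρ x (e₀ q))) (fun g z => by
        apply e₀.injective
        rw [Equiv.apply_symm_apply, QuotientGroup.mk_mul, he₀, he₀, Equiv.apply_symm_apply]
        exact (hom_ρ (c.equiv.functor.map (Φ.pullbackTempMap h36 (BTemp.rightMul hG N g))) x
          (e₀ (z : G ⧸ N.toSubgroup))).symm)
    intro z
    have h1 : ρf x = ((h : G) : G ⧸ N.toSubgroup) := by
      have := hh 1
      rw [mul_one] at this
      exact this
    rw [h1, ← QuotientGroup.mk_mul]
    exact hh z
  -- `ρf` is a group homomorphism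
  have hmul : ∀ x y : c.G, ρf (x * y) = ρf x * ρf y := fun x y => by
    obtain ⟨z, hz⟩ := QuotientGroup.mk_surjective (ρf y)
    change e₀.symm (Y.obj.ρ (x * y) (e₀ ((1 : G) : G ⧸ N.toSubgroup))) = _
    rw [ρ_mul_apply]
    have : Y.obj.ρ y (e₀ ((1 : G) : G ⧸ N.toSubgroup)) = e₀ (z : G ⧸ N.toSubgroup) := by
      rw [← Equiv.apply_symm_apply e₀ (Y.obj.ρ y _)]
      exact congrArg e₀ hz.symm
    rw [this, hleft x z, hz]
  have hone : ρf 1 = 1 := by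
    change e₀.symm (Y.obj.ρ 1 (e₀ ((1 : G) : G ⧸ N.toSubgroup))) = _
    rw [ρ_one_apply, Equiv.symm_apply_apply, QuotientGroup.mk_one]
  let ρm : c.G →* (G ⧸ N.toSubgroup) := { toFun := ρf, map_one' := hone, map_mul' := hmul }
  -- continuity: the kernel is the (open) stabiliser of the base point
  have hcont : Continuous ρm := by
    refine continuous_of_continuousAt_one ρm ?_
    have hopen : IsOpen {x : c.G | Y.obj.ρ x (e₀ ((1 : G) : G ⧸ N.toSubgroup)) = e₀ ((1 : G) : G ⧸ N.toSubgroup)} :=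
      Y.property.2 _
    rw [ContinuousAt, map_one]
    refine tendsto_nhds.mpr fun U hU h1 => ?_
    refine Filter.mem_of_superset (hopen.mem_nhds (by simp)) fun x hx => ?_
    have : ρm x = 1 := by
      change e₀.symm (Y.obj.ρ x (e₀ ((1 : G) : G ⧸ N.toSubgroup))) = 1
      rw [hx, Equiv.symm_apply_apply, QuotientGroup.mk_one]
    simpa [this] using h1
  exact ⟨⟨ρm, hcont⟩, hleft⟩

end Level

/-- **Tempered van Kampen at constant coefficients, level `N`.**  Let `H` satisfy the hypotheses of Prop. 3.6, let `G` be a compact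
totally disconnected group with an open normal subgroup `N`, and let `Φ : HomToGroup H G` be a compatible family of continuous local
homomorphisms (`Φ_v ∘ b_* = Φ_e`).  Then for EVERY chart `c` of `π₁^temp(H)` there is a continuous homomorphism
`ρ_N : π₁^temp(H) → G/N` such that for every vertex `v` and every verticial homomorphism `ψ_v` (resp. every edge `e` and edge
homomorphism `ψ_e`) the composite `ρ_N ∘ ψ_v` (resp. `ρ_N ∘ ψ_e`) is `Φ_v mod N` (resp. `Φ_e mod N`) up to conjugation in `G`.
(Construction: the monodromy of the finite Galois covering `Φ^*(G/N)` read through the Thm. 3.7 (i) identification at one vertex; it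
commutes with the deck transformations `Φ^*(r_g)`, hence acts by left translations.)  This is the «kill the graph» retraction of a graph
of groups at constant coefficients (abc-iut-f-176 gen 6's memo §3), as an actual homomorphism out of the ABSTRACT tempered fundamental
group. [cite: MochizukiSemiAnbd2006, Thm 3.7(i) p.40] -/
theorem exists_levelHom [CompactSpace G] [TotallyDisconnectedSpace G] (h36 : ℋ.Prop36Hypotheses)
    (N : OpenNormalSubgroup G) (c : TemperedPiChart ℋ) :
    ∃ ρ : c.G →ₜ* (G ⧸ N.toSubgroup),
      (∀ (v : ℋ.graph.Vertex) (ψ : ℋ.Gv v →ₜ* c.G), IsVerticialHom c v ψ →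
        ∃ k : G, ∀ γ : ℋ.Gv v, ρ (ψ γ) = ((k * Φ.fv v γ * k⁻¹ : G) : G ⧸ N.toSubgroup)) ∧
      ∀ (e : ℋ.graph.Edge) (ψ : ℋ.Ge e →ₜ* c.G), IsEdgeHom c e ψ →
        ∃ k : G, ∀ γ : ℋ.Ge e, ρ (ψ γ) = ((k * Φ.fe e γ * k⁻¹ : G) : G ⧸ N.toSubgroup) := by
  classical
  have hG : IsTempered G := IsTempered.of_profinite
  haveI : Finite (BTemp.Q hG N).obj.V := inferInstanceAs (Finite (G ⧸ N.toSubgroup))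
  -- a base vertex with a verticial homomorphism and its natural identification family
  obtain ⟨v₀⟩ := h36.hasVertex
  obtain ⟨H₀, hH₀⟩ := nonempty_verticialSubgroups h36 c v₀
  obtain ⟨ψ₀, hψ₀, -⟩ := (mem_verticialSubgroups_iff_exists_isVerticialHom c v₀ H₀).mp hH₀
  obtain ⟨ε, -, hεδ⟩ := hψ₀.exists_equiv_natural_family
  let S : BTempCat ℋ := Φ.pullbackTemp h36 (BTemp.Q hG N)
  let e₀ : (G ⧸ N.toSubgroup) ≃ (c.equiv.functor.obj S).obj.V := ε S
  have he₀ : ∀ (g : G) (q : G ⧸ N.toSubgroup), e₀ (q * (g : G ⧸ N.toSubgroup)) =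
      (c.equiv.functor.map (Φ.pullbackTempMap h36 (BTemp.rightMul hG N g))).hom.hom.hom (e₀ q) := fun g q => by
    have := hεδ S S (Φ.pullbackTempMap h36 (BTemp.rightMul hG N g)) q
    erw [pullback_rightMul_fV_apply] at this
    exact this
  obtain ⟨ρ, hρ⟩ := Φ.exists_levelHom_of_equiv hG h36 N c e₀ he₀
  have hρ1 : ∀ x : c.G, e₀.symm ((c.equiv.functor.obj S).obj.ρ x (e₀ ((1 : G) : G ⧸ N.toSubgroup))) = ρ x :=
    fun x => by rw [hρ x 1, QuotientGroup.mk_one, mul_one]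
  refine ⟨ρ, fun v ψ hψ => ?_, fun e ψ hψ => ?_⟩
  · -- vertices: the identification `ε_v` at `v` is deck-natural and `ψ`-equivariant
    obtain ⟨εv, hεvρ, hεvδ⟩ := hψ.exists_equiv_natural_family
    obtain ⟨k, hk⟩ := Φ.symm_ρ_apply_eq_conj hG h36 N c ψ.toMonoidHom (Φ.fv v).toMonoidHom e₀ (εv S) he₀
      (fun g q => by
        have := hεvδ S S (Φ.pullbackTempMap h36 (BTemp.rightMul hG N g)) q
        erw [pullback_rightMul_fV_apply] at this
        exact this)
      (fun γ z => by
        have := hεvρ S γ (z : G ⧸ N.toSubgroup)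
        erw [pullback_Q_ρV_apply] at this
        exact this)
    exact ⟨k, fun γ => by rw [← hρ1]; exact hk γ⟩
  · -- edges: the identification `ε_e` at `e`
    obtain ⟨εe, hεeρ, hεeδ⟩ := hψ.exists_equiv_natural_family
    obtain ⟨k, hk⟩ := Φ.symm_ρ_apply_eq_conj hG h36 N c ψ.toMonoidHom (Φ.fe e).toMonoidHom e₀ (εe S) he₀
      (fun g q => by
        have := hεeδ S S (Φ.pullbackTempMap h36 (BTemp.rightMul hG N g)) q
        erw [pullback_rightMul_fE_apply] at this
        exact this)
      (fun γ z => by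
        have := hεeρ S γ (z : G ⧸ N.toSubgroup)
        erw [pullback_Q_ρE_apply] at this
        exact this)
    exact ⟨k, fun γ => by rw [← hρ1]; exact hk γ⟩

/-! ### 5. FINITE coefficient groups: `ρ : π₁^temp(H) → G` (characters, folds, permutation representations) -/

/-- **Tempered van Kampen at constant coefficients, FINITE `G`.**  For a compatible family `Φ : HomToGroup H G` of continuous local
homomorphisms to a FINITE (discrete) group `G` and every chart `c` of `π₁^temp(H)` (`H` as in Prop. 3.6), there is a continuous
homomorphism `ρ : π₁^temp(H) → G` whose composite with every verticial homomorphism `ψ_v` (resp. edge homomorphism `ψ_e`) is `Φ_v`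
(resp. `Φ_e`) up to conjugation in `G`.  This is the case used to build CHARACTERS and FOLDS of `π₁^temp(H)` onto finite groups
from local data (e.g. abc-iut-f-176's `not_exists_edgeLike_ge_of_character` / `_of_separated` take such a `ρ`).
[cite: MochizukiSemiAnbd2006, Thm 3.7(i) p.40] -/
theorem exists_hom_of_finite [Finite G] [DiscreteTopology G] (h36 : ℋ.Prop36Hypotheses) (c : TemperedPiChart ℋ) :
    ∃ ρ : c.G →ₜ* G,
      (∀ (v : ℋ.graph.Vertex) (ψ : ℋ.Gv v →ₜ* c.G), IsVerticialHom c v ψ →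
        ∃ k : G, ∀ γ : ℋ.Gv v, ρ (ψ γ) = k * Φ.fv v γ * k⁻¹) ∧
      ∀ (e : ℋ.graph.Edge) (ψ : ℋ.Ge e →ₜ* c.G), IsEdgeHom c e ψ →
        ∃ k : G, ∀ γ : ℋ.Ge e, ρ (ψ γ) = k * Φ.fe e γ * k⁻¹ := by
  -- the trivial subgroup is open normal in the discrete group `G`
  let N : OpenNormalSubgroup G := ⟨⟨⊥, isOpen_discrete _⟩, inferInstance⟩
  obtain ⟨ρ, hV, hE⟩ := Φ.exists_levelHom h36 N c
  -- `G/⊥ ≃ G`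
  let π : (G ⧸ N.toSubgroup) →* G := QuotientGroup.lift N.toSubgroup (MonoidHom.id G) (fun x hx => by
    change x ∈ (⊥ : Subgroup G) at hx
    rw [Subgroup.mem_bot] at hx
    simp [hx])
  have hπ : ∀ x : G, π ((x : G) : G ⧸ N.toSubgroup) = x := fun x => QuotientGroup.lift_mk' _ _ x
  let π' : (G ⧸ N.toSubgroup) →ₜ* G := ⟨π, continuous_of_discreteTopology⟩
  refine ⟨π'.comp ρ, fun v ψ hψ => ?_, fun e ψ hψ => ?_⟩
  · obtain ⟨k, hk⟩ := hV v ψ hψ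
    exact ⟨k, fun γ => by
      change π (ρ (ψ γ)) = _
      rw [hk γ, hπ]⟩
  · obtain ⟨k, hk⟩ := hE e ψ hψ
    exact ⟨k, fun γ => by
      change π (ρ (ψ γ)) = _
      rw [hk γ, hπ]⟩

end HomToGroup

end ProfiniteSemiGraph

end Literature.AnabelianGeometry.SemiGraphs
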